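import Summits.CriticalPhenomena.PercolationContinuityZ3.Theorems.PercNearOneGluingNoHeavyConstsClusterSquareNDCPos
import HarnessLib

/-!
# The cluster-square inequality up to QUADRUPLE clashes: all four witness pairs of the two-copy closed-witness BK

builds on p205010 (kernel theorem, internal audit signed; external expert review pending)

PAPER-2 track "percolation constants", part (ii), seat `prim-consts-1`, gen 18 (lane index
`run/shared/lean/prim/consts/CONSTANTS.md`, row A19; memo `FROM-prim-consts-1-g18-QUAD-CLASH.md`).
Support file for the crux `NoHeavyLowerTail` (stmt-CriticalPhenomena-4575; `--supports`).  Theorems only; no sorries.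

Notation (finite weighted graph, `μ = prodBernoulli w`, vertices `a, b, c`): `X = a|b|c`, `U = μ(b ↮ c)`, `K = C_a(C₁)`, `S = S(C₁)`
the pairs revealed by the exploration of `K`, `C₃ = C₁ →_S C₂`, `T = ∫_{D_a} u² dμ = P(C₁ ∈ X, C₃ ∈ X)` (`Consts.clusterSquare`,
`Consts.setIntegral_sepOff_sq_eq_Pr2W`); CSQ (`Consts.ClusterSquareSplit`) is `T ≤ U²`.

THE POINT.  Gen 17 (`…ConstsClusterSquareNDC.lean`) fed the closed-witness decision-tree vdBK inequality with the two CROSS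
witness pairs (`∂⁺C_b(C₁)`, `∂⁺C_c(C₃)`) and (`∂⁺C_c(C₁)`, `∂⁺C_b(C₃)`), which are disjoint on `S` unless a vertex of
`C_b(C₁) ∩ C_c(C₃)`, resp. of `C_c(C₁) ∩ C_b(C₃)`, is joined to `K` by a positive pair ("double clash").  The two SAME-SIDE pairs
(`∂⁺C_b(C₁)`, `∂⁺C_b(C₃)`) and (`∂⁺C_c(C₁)`, `∂⁺C_c(C₃)`) are witness pairs as well (`Consts.exists_closedWitness_of_noSameClash`):
they are disjoint on `S` unless a vertex of `C_b(C₁) ∩ C_b(C₃)`, resp. of `C_c(C₁) ∩ C_c(C₃)`, is joined to `K` by a positive pair —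
e.g. `b` itself, resp. `c` itself, when adjacent to `K`.  Hence

* `Consts.setIntegral_sepOff_sq_le_sq_add_quadClash` — for EVERY finite weighted graph, `T ≤ μ(b↮c)² + P(E ∩ {quadruple clash})`,
  a quadruple clash of the pair `(C₁, C₂) ∈ E` being FOUR vertices `y ∈ C_b(C₁) ∩ C_c(C₃)`, `y' ∈ C_c(C₁) ∩ C_b(C₃)`,
  `z ∈ C_b(C₁) ∩ C_b(C₃)`, `z' ∈ C_c(C₁) ∩ C_c(C₃)`, each joined to `K` by a positive pair (they are automatically pairwise distinct
  and outside `K`; `z = b` / `z' = c` are possible);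
* **`Consts.clusterSquare_le_sq_of_noQuadClash_pos`** — CSQ at `(a; b, c)` when no quadruple clash occurs among configurations of
  positive pairs; `Consts.sq_real_split_le_of_noQuadClash_pos` (DUU at the root `a`), `Consts.tripleSplit_of_noQuadClash_pos` (TS);
* `Consts.noQuadClash_of_noDoubleClash` — the gen-17 hypothesis implies the new one (all gen-17 criteria still apply).

This is the EXACT reach of the closed-witness two-copy method: a minimal closed witness of `{b ↮ c}` in `C₁` is `∂W` for a union `W`
of `C₁`-clusters containing `C_b(C₁)` and not `C_c(C₁)`, `K` lies inside or outside `W`, and `∂W ∩ S = E(K, V ∖ W)` resp. `E(W, K)`; so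
the four boundary pairs are the only candidates (seat engine `eng/bad4_verify.py`: the disjoint-witness event is `E ∖ {quadruple clash}`
⊔ {`K ∋` one terminal, the other terminal `t ∉ N(K)`, no vertex of `C_t(C₁) ∩ C_t(C₃)` adjacent to `K`} on `K₄, K₅, W₄, K₂,₃, C₅, G₇`).
NEW CASES (seat census `eng/c/bad4census.c`): every rooted graph on 5 vertices except `W₄` rooted at the hub with `b, c` antipodal,
`K₅ − e` (6 placements), `K₅`; `K₂,₃` at every placement; `G₇` (gen-15 memo) rooted at `b`; on 6 vertices 5 834 / 6 720 rooted placements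
(NDC: 5 286), 2 003 / 2 240 triples (NDC: 1 762).  What remains: `K₅`-type cores.
References: N. Gladkov, arXiv:2408.08457v2 (2024), Def. 4.2, Thm. 4.3, Lemma 3.1, Ex. 2.5, Thm. 5.2; J. van den Berg, O. Häggström,
J. Kahn, Random Structures Algorithms 29 (2006), §1 p. 8.
-/

noncomputable section

open Classical
namespace Summit.CriticalPhenomena.PercolationContinuityZ3.Theorems

open MeasureTheory Finset Literature.Probability.LatticeModels Literature.Probability.Percolation
open Literature.Probability.Percolation.DecisionTree Literature.Probability.Percolation.BHK2006
open Literature.Probability.Percolation.TargetExploration Literature.Probability.Percolation.ClusterConditioning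

namespace Consts

section General

variable {V : Type*} [Fintype V]

/-- **The same-side witness pair.**  Let `S = S(C₁)` be the set revealed by the exploration of `C_a(C₁)` and `C₃ = C₁ →_S C₂`.
If `a ↮ s` in `C₁`, `s ↮ t` in `C₁` and in `C₃`, and NO vertex of `C_s(C₁) ∩ C_s(C₃)` is joined to `C_a(C₁)` by a pair of positive
weight, then `I = ∂⁺C_s(C₁)` and `J = ∂⁺C_s(C₃)` (positive boundaries of the cluster of the SAME terminal `s` in the two
configurations) are closed in `C₁` resp. `C₃`, force `{s ↮ t}`, and are disjoint on `S`.
[cite: Gladkov2024, Def. 4.2 and Example 2.5 (the revealed set of the cluster exploration)] -/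
theorem exists_closedWitness_of_noSameClash {P : Finset (Sym2 V)} (w : Sym2 V → unitInterval)
    (hP : ∀ e, e ∈ P ↔ (0 : ℝ) < w e) (a s t : V) (K₁ K₂ : Finset (Sym2 V))
    (has : ¬ (openGraph (↑K₁ : Set (Sym2 V))).Reachable a s)
    (hst : ¬ (openGraph (↑K₁ : Set (Sym2 V))).Reachable s t)
    (hst₃ : ¬ (openGraph (↑(splice (revealedAt (Finset.univ : Finset (Sym2 V)) (∅ : Finset V) a K₁) K₁ K₂) :
      Set (Sym2 V))).Reachable s t)
    (hno : ¬ ∃ y k : V, (openGraph (↑K₁ : Set (Sym2 V))).Reachable a k ∧ (0 : ℝ) < w s(k, y) ∧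
      (openGraph (↑K₁ : Set (Sym2 V))).Reachable s y ∧
      (openGraph (↑(splice (revealedAt (Finset.univ : Finset (Sym2 V)) (∅ : Finset V) a K₁) K₁ K₂) :
        Set (Sym2 V))).Reachable s y) :
    ∃ I J : Finset (Sym2 V), Disjoint I K₁ ∧
      Iᶜ ∈ {C : Finset (Sym2 V) | ¬ (openGraph (↑(C ∩ P) : Set (Sym2 V))).Reachable s t} ∧
      Disjoint J (splice (revealedAt (Finset.univ : Finset (Sym2 V)) (∅ : Finset V) a K₁) K₁ K₂) ∧
      Jᶜ ∈ {C : Finset (Sym2 V) | ¬ (openGraph (↑(C ∩ P) : Set (Sym2 V))).Reachable s t} ∧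
      ∀ i ∈ I, i ∈ J → i ∉ revealedAt (Finset.univ : Finset (Sym2 V)) (∅ : Finset V) a K₁ := by
  set K₃ := splice (revealedAt (Finset.univ : Finset (Sym2 V)) (∅ : Finset V) a K₁) K₁ K₂ with hK₃
  set I := P.filter fun e => ∃ y z : V, e = s(y, z) ∧ (openGraph (↑K₁ : Set (Sym2 V))).Reachable s y ∧
    ¬ (openGraph (↑K₁ : Set (Sym2 V))).Reachable s z with hI
  set J := P.filter fun e => ∃ y z : V, e = s(y, z) ∧ (openGraph (↑K₃ : Set (Sym2 V))).Reachable s y ∧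
    ¬ (openGraph (↑K₃ : Set (Sym2 V))).Reachable s z with hJ
  refine ⟨I, J, Finset.disjoint_left.2 fun e he => not_mem_of_mem_boundary he, compl_boundary_mem_posSep hst,
    Finset.disjoint_left.2 fun e he => not_mem_of_mem_boundary he, compl_boundary_mem_posSep hst₃,
    fun i hiI hiJ hiS => ?_⟩
  -- a pair in both boundaries and in the revealed set produces a same-side clash
  obtain ⟨u, hui, hau⟩ := exists_reachable_of_mem_revealedAt hiS
  obtain ⟨hiP, y, z, hi, hy, hz⟩ := Finset.mem_filter.1 hiI
  obtain ⟨-, y', z', hi', hy', hz'⟩ := Finset.mem_filter.1 hiJ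
  -- the endpoint joined to `a` is `z` (the other endpoint `y` is joined to `s`)
  have hz₁ : (openGraph (↑K₁ : Set (Sym2 V))).Reachable a z := by
    rw [hi] at hui
    rcases Sym2.mem_iff.1 hui with h | h
    · exact absurd (hau.trans (h ▸ hy).symm) has
    · exact h ▸ hau
  have hz₃ : (openGraph (↑K₃ : Set (Sym2 V))).Reachable a z := (reachable_hybrid_iff a K₁ K₂ z).2 hz₁
  rcases Sym2.eq_iff.1 (hi.symm.trans hi') with ⟨hyy, -⟩ | ⟨-, hzy⟩
  · -- `y = y'`: `y ∈ C_s(C₁) ∩ C_s(C₃)` is joined to `z ∈ C_a(C₁)` by the positive pair `i`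
    refine hno ⟨y, z, hz₁, ?_, hy, ?_⟩
    · have h0 : (0 : ℝ) < w i := (hP i).1 hiP
      rw [hi, Sym2.eq_swap] at h0
      exact h0
    · rw [hyy]; exact hy'
  · -- `z = y'`: then `s ↔ z ↔ a` in `C₃`, i.e. `a ↔ s` in `C₁`, a contradiction
    have h1 : (openGraph (↑K₃ : Set (Sym2 V))).Reachable s z := by rw [hzy]; exact hy'
    exact has ((reachable_hybrid_iff a K₁ K₂ s).1 (hz₃.trans h1.symm))

/-! ### The cluster-square inequality up to the quadruple-clash pairs, and under "no quadruple clash" -/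

/-- **`T ≤ U² + P(quadruple-clash pairs)` (every finite weighted graph).**  With `E = {(C₁, C₂) : C₁ ∈ X, C₁ →_S C₂ ∈ X}` (so
`T = P(E)`), every pair of `E` WITHOUT a quadruple clash — not all four of: some `y ∈ C_b(C₁) ∩ C_c(C₃)`, some
`y' ∈ C_c(C₁) ∩ C_b(C₃)`, some `z ∈ C_b(C₁) ∩ C_b(C₃)`, some `z' ∈ C_c(C₁) ∩ C_c(C₃)` joined to `C_a(C₁)` by pairs of positive
weight — carries one of the four boundary witness pairs disjoint on `S`, so these pairs have probability at most `μ(b ↮ c)²` by the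
closed-witness decision-tree vdBK inequality; hence `∫_{D_a} u² dμ ≤ μ(b↮c)² + P(E ∩ {quadruple clash})`.
[cite: Gladkov2024, Thm. 4.3 with Def. 4.2, Lemma 3.1, Example 2.5] -/
theorem setIntegral_sepOff_sq_le_sq_add_quadClash (w : Sym2 V → unitInterval) (a b c : V) :
    (∫ ω in (openConn a b)ᶜ ∩ (openConn a c)ᶜ,
        (prodBernoulli w).real {η | ¬ (openGraph (η \ barOf {a} (setCl ω {a}))).Reachable b c} ^ 2 ∂(prodBernoulli w)) ≤
      (prodBernoulli w).real (openConn b c)ᶜ ^ 2 +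
        Pr2W Finset.univ (fun e => (w e : ℝ))
          ({x : Finset (Sym2 V) × Finset (Sym2 V) |
              (↑x.1 : Set (Sym2 V)) ∈ (openConn a b)ᶜ ∩ (openConn a c)ᶜ ∩ (openConn b c)ᶜ ∧
              (↑(splice (revealedAt (Finset.univ : Finset (Sym2 V)) (∅ : Finset V) a x.1) x.1 x.2) : Set (Sym2 V)) ∈
                (openConn a b)ᶜ ∩ (openConn a c)ᶜ ∩ (openConn b c)ᶜ} ∩
            {x | (∃ y k : V, (openGraph (↑x.1 : Set (Sym2 V))).Reachable a k ∧ (0 : ℝ) < w s(k, y) ∧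
                  (openGraph (↑x.1 : Set (Sym2 V))).Reachable b y ∧
                  (openGraph (↑(splice (revealedAt (Finset.univ : Finset (Sym2 V)) (∅ : Finset V) a x.1) x.1 x.2) :
                    Set (Sym2 V))).Reachable c y) ∧
                (∃ y k : V, (openGraph (↑x.1 : Set (Sym2 V))).Reachable a k ∧ (0 : ℝ) < w s(k, y) ∧
                  (openGraph (↑x.1 : Set (Sym2 V))).Reachable c y ∧
                  (openGraph (↑(splice (revealedAt (Finset.univ : Finset (Sym2 V)) (∅ : Finset V) a x.1) x.1 x.2) :
                    Set (Sym2 V))).Reachable b y) ∧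
                (∃ y k : V, (openGraph (↑x.1 : Set (Sym2 V))).Reachable a k ∧ (0 : ℝ) < w s(k, y) ∧
                  (openGraph (↑x.1 : Set (Sym2 V))).Reachable b y ∧
                  (openGraph (↑(splice (revealedAt (Finset.univ : Finset (Sym2 V)) (∅ : Finset V) a x.1) x.1 x.2) :
                    Set (Sym2 V))).Reachable b y) ∧
                (∃ y k : V, (openGraph (↑x.1 : Set (Sym2 V))).Reachable a k ∧ (0 : ℝ) < w s(k, y) ∧
                  (openGraph (↑x.1 : Set (Sym2 V))).Reachable c y ∧
                  (openGraph (↑(splice (revealedAt (Finset.univ : Finset (Sym2 V)) (∅ : Finset V) a x.1) x.1 x.2) :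
                    Set (Sym2 V))).Reachable c y)}) := by
  set p : Sym2 V → ℝ := fun e => (w e : ℝ) with hp
  have hp0 : ∀ e, 0 ≤ p e := fun e => (w e).2.1
  have hp1 : ∀ e, p e ≤ 1 := fun e => (w e).2.2
  set P : Finset (Sym2 V) := Finset.univ.filter fun e => (0 : ℝ) < w e with hPdef
  have hP : ∀ e, e ∈ P ↔ (0 : ℝ) < w e := fun e => by simp [hPdef]
  set Xs : Set (Set (Sym2 V)) := (openConn a b)ᶜ ∩ (openConn a c)ᶜ ∩ (openConn b c)ᶜ with hXs
  set A : Set (Finset (Sym2 V)) := {C | ¬ (openGraph (↑(C ∩ P) : Set (Sym2 V))).Reachable b c} with hA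
  set E : Set (Finset (Sym2 V) × Finset (Sym2 V)) := {x | (↑x.1 : Set (Sym2 V)) ∈ Xs ∧
    (↑(splice (revealedAt (Finset.univ : Finset (Sym2 V)) (∅ : Finset V) a x.1) x.1 x.2) : Set (Sym2 V)) ∈ Xs} with hE
  set Bad : Set (Finset (Sym2 V) × Finset (Sym2 V)) := {x |
    (∃ y k : V, (openGraph (↑x.1 : Set (Sym2 V))).Reachable a k ∧ (0 : ℝ) < w s(k, y) ∧
      (openGraph (↑x.1 : Set (Sym2 V))).Reachable b y ∧
      (openGraph (↑(splice (revealedAt (Finset.univ : Finset (Sym2 V)) (∅ : Finset V) a x.1) x.1 x.2) :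
        Set (Sym2 V))).Reachable c y) ∧
    (∃ y k : V, (openGraph (↑x.1 : Set (Sym2 V))).Reachable a k ∧ (0 : ℝ) < w s(k, y) ∧
      (openGraph (↑x.1 : Set (Sym2 V))).Reachable c y ∧
      (openGraph (↑(splice (revealedAt (Finset.univ : Finset (Sym2 V)) (∅ : Finset V) a x.1) x.1 x.2) :
        Set (Sym2 V))).Reachable b y) ∧
    (∃ y k : V, (openGraph (↑x.1 : Set (Sym2 V))).Reachable a k ∧ (0 : ℝ) < w s(k, y) ∧
      (openGraph (↑x.1 : Set (Sym2 V))).Reachable b y ∧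
      (openGraph (↑(splice (revealedAt (Finset.univ : Finset (Sym2 V)) (∅ : Finset V) a x.1) x.1 x.2) :
        Set (Sym2 V))).Reachable b y) ∧
    (∃ y k : V, (openGraph (↑x.1 : Set (Sym2 V))).Reachable a k ∧ (0 : ℝ) < w s(k, y) ∧
      (openGraph (↑x.1 : Set (Sym2 V))).Reachable c y ∧
      (openGraph (↑(splice (revealedAt (Finset.univ : Finset (Sym2 V)) (∅ : Finset V) a x.1) x.1 x.2) :
        Set (Sym2 V))).Reachable c y)} with hBad
  set CW : Set (Finset (Sym2 V) × Finset (Sym2 V)) := {x | ∃ I J : Finset (Sym2 V), Disjoint I x.1 ∧ Iᶜ ∈ A ∧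
    Disjoint J (splice (revealedAt (Finset.univ : Finset (Sym2 V)) (∅ : Finset V) a x.1) x.1 x.2) ∧ Jᶜ ∈ A ∧
    ∀ i ∈ I, i ∈ J → i ∉ revealedAt (Finset.univ : Finset (Sym2 V)) (∅ : Finset V) a x.1} with hCW
  rw [setIntegral_sepOff_sq_eq_Pr2W]
  -- the pairs of `E` without a quadruple clash lie in the closed-witness disjoint occurrence of `A, A`
  have hsub : ∀ x : Finset (Sym2 V) × Finset (Sym2 V), x ∈ E \ Bad → x ∈ CW := by
    rintro ⟨K₁, K₂⟩ ⟨⟨h1, h3⟩, hgood⟩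
    have hab : ¬ (openGraph (↑K₁ : Set (Sym2 V))).Reachable a b := h1.1.1
    have hac : ¬ (openGraph (↑K₁ : Set (Sym2 V))).Reachable a c := h1.1.2
    have hbc : ¬ (openGraph (↑K₁ : Set (Sym2 V))).Reachable b c := h1.2
    have hbc₃ : ¬ (openGraph (↑(splice (revealedAt (Finset.univ : Finset (Sym2 V)) (∅ : Finset V) a K₁) K₁ K₂) :
        Set (Sym2 V))).Reachable b c := h3.2
    show ∃ I J : Finset (Sym2 V), Disjoint I K₁ ∧ Iᶜ ∈ A ∧
        Disjoint J (splice (revealedAt (Finset.univ : Finset (Sym2 V)) (∅ : Finset V) a K₁) K₁ K₂) ∧ Jᶜ ∈ A ∧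
        ∀ i ∈ I, i ∈ J → i ∉ revealedAt (Finset.univ : Finset (Sym2 V)) (∅ : Finset V) a K₁
    by_cases hcl : ∃ y k : V, (openGraph (↑K₁ : Set (Sym2 V))).Reachable a k ∧ (0 : ℝ) < w s(k, y) ∧
        (openGraph (↑K₁ : Set (Sym2 V))).Reachable b y ∧
        (openGraph (↑(splice (revealedAt (Finset.univ : Finset (Sym2 V)) (∅ : Finset V) a K₁) K₁ K₂) :
          Set (Sym2 V))).Reachable c y
    · by_cases hcl' : ∃ y k : V, (openGraph (↑K₁ : Set (Sym2 V))).Reachable a k ∧ (0 : ℝ) < w s(k, y) ∧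
          (openGraph (↑K₁ : Set (Sym2 V))).Reachable c y ∧
          (openGraph (↑(splice (revealedAt (Finset.univ : Finset (Sym2 V)) (∅ : Finset V) a K₁) K₁ K₂) :
            Set (Sym2 V))).Reachable b y
      · by_cases hsb : ∃ y k : V, (openGraph (↑K₁ : Set (Sym2 V))).Reachable a k ∧ (0 : ℝ) < w s(k, y) ∧
            (openGraph (↑K₁ : Set (Sym2 V))).Reachable b y ∧
            (openGraph (↑(splice (revealedAt (Finset.univ : Finset (Sym2 V)) (∅ : Finset V) a K₁) K₁ K₂) :
              Set (Sym2 V))).Reachable b y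
        · -- three clashes occur, so the same-side pair at `c` does not clash: witnesses `∂⁺C_c(C₁)`, `∂⁺C_c(C₃)`
          have hno : ¬ ∃ y k : V, (openGraph (↑K₁ : Set (Sym2 V))).Reachable a k ∧ (0 : ℝ) < w s(k, y) ∧
              (openGraph (↑K₁ : Set (Sym2 V))).Reachable c y ∧
              (openGraph (↑(splice (revealedAt (Finset.univ : Finset (Sym2 V)) (∅ : Finset V) a K₁) K₁ K₂) :
                Set (Sym2 V))).Reachable c y := fun h4 => hgood ⟨hcl, hcl', hsb, h4⟩
          obtain ⟨I, J, hI, hIA, hJ, hJA, hIJ⟩ := exists_closedWitness_of_noSameClash w hP a c b K₁ K₂ hac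
            (fun h => hbc h.symm) (fun h => hbc₃ h.symm) hno
          exact ⟨I, J, hI, fun h => hIA h.symm, hJ, fun h => hJA h.symm, hIJ⟩
        · -- the same-side pair at `b`: witnesses `∂⁺C_b(C₁)`, `∂⁺C_b(C₃)`
          exact exists_closedWitness_of_noSameClash w hP a b c K₁ K₂ hab hbc hbc₃ hsb
      · -- the cross pair (`∂⁺C_c(C₁)`, `∂⁺C_b(C₃)`)
        obtain ⟨I, J, hI, hIA, hJ, hJA, hIJ⟩ := exists_closedWitness_of_noClash w hP a c b K₁ K₂ hac
          (fun h => hbc h.symm) (fun h => hbc₃ h.symm) hab hcl'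
        exact ⟨I, J, hI, fun h => hIA h.symm, hJ, fun h => hJA h.symm, hIJ⟩
    · -- the cross pair (`∂⁺C_b(C₁)`, `∂⁺C_c(C₃)`)
      exact exists_closedWitness_of_noClash w hP a b c K₁ K₂ hab hbc hbc₃ hac hcl
  -- the closed-witness decision-tree vdBK inequality for the exploration tree of `C_a`
  have key := ClosedBK.Pr2W_closedWitness_le hp0 hp1
    (ttree (Finset.univ : Finset (Sym2 V)) (∅ : Finset V) ((Finset.univ : Finset (Sym2 V)).card + 1)
      (TargetExploration.init a)) (isLowerSet_posSep P b c) (isLowerSet_posSep P b c)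
  simp only [← revealedAt_eq_revealed] at key
  have hmono : Pr2W Finset.univ p (E \ Bad) ≤ Pr2W Finset.univ p CW := by
    refine Pr2W_mono Finset.univ hp0 hp1 ?_
    intro x _ _ hx
    exact hsub x hx
  have hU : PrW Finset.univ p A = (prodBernoulli w).real (openConn b c)ᶜ := PrW_posSep_eq w hP b c
  rw [hU] at key
  rw [Pr2W_eq_inter_add_diff Finset.univ p E Bad, sq, add_comm]
  exact add_le_add (hmono.trans key) le_rfl

/-- **CSQ at `(a; b, c)` when no quadruple clash occurs among configurations of POSITIVE pairs** (general finite vertex type).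
Hypothesis: for all configurations `ω, η` of positive pairs with `a ↮ b`, `a ↮ c`, `b ↮ c` in `ω` and `b ↮ c` in `η'` := `η` with the
pairs meeting `{a} ∪ V(C_a(ω))` deleted, NOT all four of: some `y` with `b ↔ y` in `ω`, `c ↔ y` in `η'`; some `y'` with `c ↔ y'` in
`ω`, `b ↔ y'` in `η'`; some `z` with `b ↔ z` in `ω` and in `η'`; some `z'` with `c ↔ z'` in `ω` and in `η'` — each joined to `C_a(ω)`
by a pair of positive weight.  Conclusion: `∫_{D_a} u² dμ ≤ μ(b ↮ c)²`.
[cite: Gladkov2024, Thm. 4.3 (decision-tree vdBK) with Def. 4.2, Lemma 3.1, Example 2.5] -/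
theorem setIntegral_sepOff_sq_le_of_noQuadClash_pos (w : Sym2 V → unitInterval) (a b c : V)
    (hnqc : ∀ ω η : Set (Sym2 V), (∀ e ∈ ω, (0 : ℝ) < w e) → (∀ e ∈ η, (0 : ℝ) < w e) →
      ¬ (openGraph ω).Reachable a b → ¬ (openGraph ω).Reachable a c →
      ¬ (openGraph ω).Reachable b c → ¬ (openGraph (η \ barOf {a} (setCl ω {a}))).Reachable b c →
      ¬ ((∃ y k : V, (openGraph ω).Reachable a k ∧ (0 : ℝ) < w s(k, y) ∧ (openGraph ω).Reachable b y ∧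
            (openGraph (η \ barOf {a} (setCl ω {a}))).Reachable c y) ∧
         (∃ y k : V, (openGraph ω).Reachable a k ∧ (0 : ℝ) < w s(k, y) ∧ (openGraph ω).Reachable c y ∧
            (openGraph (η \ barOf {a} (setCl ω {a}))).Reachable b y) ∧
         (∃ y k : V, (openGraph ω).Reachable a k ∧ (0 : ℝ) < w s(k, y) ∧ (openGraph ω).Reachable b y ∧
            (openGraph (η \ barOf {a} (setCl ω {a}))).Reachable b y) ∧
         (∃ y k : V, (openGraph ω).Reachable a k ∧ (0 : ℝ) < w s(k, y) ∧ (openGraph ω).Reachable c y ∧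
            (openGraph (η \ barOf {a} (setCl ω {a}))).Reachable c y))) :
    (∫ ω in (openConn a b)ᶜ ∩ (openConn a c)ᶜ,
        (prodBernoulli w).real {η | ¬ (openGraph (η \ barOf {a} (setCl ω {a}))).Reachable b c} ^ 2 ∂(prodBernoulli w)) ≤
      (prodBernoulli w).real (openConn b c)ᶜ ^ 2 := by
  set p : Sym2 V → ℝ := fun e => (w e : ℝ) with hp
  have hp0 : ∀ e, 0 ≤ p e := fun e => (w e).2.1
  have hp1 : ∀ e, p e ≤ 1 := fun e => (w e).2.2
  set P : Finset (Sym2 V) := Finset.univ.filter fun e => (0 : ℝ) < w e with hPdef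
  have hP : ∀ e, e ∈ P ↔ (0 : ℝ) < w e := fun e => by simp [hPdef]
  refine (setIntegral_sepOff_sq_le_sq_add_quadClash w a b c).trans ?_
  rw [Pr2W_eq_Pr2W_inter_supported w hP]
  have hcut : ∀ (K₁ K₂ : Finset (Sym2 V)) (t y : V), ¬ (openGraph (↑K₁ : Set (Sym2 V))).Reachable a t →
      ((openGraph (↑(splice (revealedAt (Finset.univ : Finset (Sym2 V)) (∅ : Finset V) a K₁) K₁ K₂) :
        Set (Sym2 V))).Reachable t y ↔
      (openGraph ((↑K₂ : Set (Sym2 V)) \ barOf {a} (setCl (↑K₁ : Set (Sym2 V)) {a}))).Reachable t y) := by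
    intro K₁ K₂ t y hat
    rw [← hybrid_coe_splice, reachable_hybrid_iff_diff_cutSet hat, barOf_setCl_singleton_eq_cutSet]
  have hle : Pr2W Finset.univ p
      (({x : Finset (Sym2 V) × Finset (Sym2 V) |
          (↑x.1 : Set (Sym2 V)) ∈ (openConn a b)ᶜ ∩ (openConn a c)ᶜ ∩ (openConn b c)ᶜ ∧
          (↑(splice (revealedAt (Finset.univ : Finset (Sym2 V)) (∅ : Finset V) a x.1) x.1 x.2) : Set (Sym2 V)) ∈
            (openConn a b)ᶜ ∩ (openConn a c)ᶜ ∩ (openConn b c)ᶜ} ∩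
        {x | (∃ y k : V, (openGraph (↑x.1 : Set (Sym2 V))).Reachable a k ∧ (0 : ℝ) < w s(k, y) ∧
              (openGraph (↑x.1 : Set (Sym2 V))).Reachable b y ∧
              (openGraph (↑(splice (revealedAt (Finset.univ : Finset (Sym2 V)) (∅ : Finset V) a x.1) x.1 x.2) :
                Set (Sym2 V))).Reachable c y) ∧
            (∃ y k : V, (openGraph (↑x.1 : Set (Sym2 V))).Reachable a k ∧ (0 : ℝ) < w s(k, y) ∧
              (openGraph (↑x.1 : Set (Sym2 V))).Reachable c y ∧
              (openGraph (↑(splice (revealedAt (Finset.univ : Finset (Sym2 V)) (∅ : Finset V) a x.1) x.1 x.2) :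
                Set (Sym2 V))).Reachable b y) ∧
            (∃ y k : V, (openGraph (↑x.1 : Set (Sym2 V))).Reachable a k ∧ (0 : ℝ) < w s(k, y) ∧
              (openGraph (↑x.1 : Set (Sym2 V))).Reachable b y ∧
              (openGraph (↑(splice (revealedAt (Finset.univ : Finset (Sym2 V)) (∅ : Finset V) a x.1) x.1 x.2) :
                Set (Sym2 V))).Reachable b y) ∧
            (∃ y k : V, (openGraph (↑x.1 : Set (Sym2 V))).Reachable a k ∧ (0 : ℝ) < w s(k, y) ∧
              (openGraph (↑x.1 : Set (Sym2 V))).Reachable c y ∧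
              (openGraph (↑(splice (revealedAt (Finset.univ : Finset (Sym2 V)) (∅ : Finset V) a x.1) x.1 x.2) :
                Set (Sym2 V))).Reachable c y)}) ∩
        {x : Finset (Sym2 V) × Finset (Sym2 V) | x.1 ⊆ P ∧ x.2 ⊆ P}) ≤
      Pr2W Finset.univ p (∅ : Set (Finset (Sym2 V) × Finset (Sym2 V))) := by
    refine Pr2W_mono Finset.univ hp0 hp1 ?_
    rintro ⟨K₁, K₂⟩ - - ⟨⟨⟨h1, h3⟩, ⟨y, k, hk, hw, hby, hcy⟩, ⟨y', k', hk', hw', hcy', hby'⟩, ⟨z, l, hl, hwz, hbz, hbz₃⟩,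
      ⟨z', l', hl', hwz', hcz, hcz₃⟩⟩, ⟨hK₁, hK₂⟩⟩
    have hab : ¬ (openGraph (↑K₁ : Set (Sym2 V))).Reachable a b := h1.1.1
    have hac : ¬ (openGraph (↑K₁ : Set (Sym2 V))).Reachable a c := h1.1.2
    have hbc : ¬ (openGraph (↑K₁ : Set (Sym2 V))).Reachable b c := h1.2
    have hbc₃ : ¬ (openGraph ((↑K₂ : Set (Sym2 V)) \ barOf {a} (setCl (↑K₁ : Set (Sym2 V)) {a}))).Reachable b c :=
      fun h => h3.2 ((hcut K₁ K₂ b c hab).2 h)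
    have hpos₁ : ∀ e ∈ (↑K₁ : Set (Sym2 V)), (0 : ℝ) < w e := fun e he => (hP e).1 (hK₁ (Finset.mem_coe.1 he))
    have hpos₂ : ∀ e ∈ (↑K₂ : Set (Sym2 V)), (0 : ℝ) < w e := fun e he => (hP e).1 (hK₂ (Finset.mem_coe.1 he))
    exact (hnqc ↑K₁ ↑K₂ hpos₁ hpos₂ hab hac hbc hbc₃ ⟨⟨y, k, hk, hw, hby, (hcut K₁ K₂ c y hac).1 hcy⟩,
      ⟨y', k', hk', hw', hcy', (hcut K₁ K₂ b y' hab).1 hby'⟩, ⟨z, l, hl, hwz, hbz, (hcut K₁ K₂ b z hab).1 hbz₃⟩,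
      ⟨z', l', hl', hwz', hcz, (hcut K₁ K₂ c z' hac).1 hcz₃⟩⟩).elim
  have h0 : Pr2W Finset.univ p (∅ : Set (Finset (Sym2 V) × Finset (Sym2 V))) = 0 := by simp [Pr2W]
  linarith

omit [Fintype V] in
/-- **No double clash ⟹ no quadruple clash**: the gen-17 hypothesis (for configurations of positive pairs) implies the new one, so
every combinatorial criterion for "no double clash" is a criterion for "no quadruple clash". [folklore] -/
theorem noQuadClash_of_noDoubleClash (w : Sym2 V → unitInterval) (a b c : V)
    (hndc : ∀ ω η : Set (Sym2 V), (∀ e ∈ ω, (0 : ℝ) < w e) → (∀ e ∈ η, (0 : ℝ) < w e) →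
      ¬ (openGraph ω).Reachable a b → ¬ (openGraph ω).Reachable a c →
      ¬ (openGraph ω).Reachable b c → ¬ (openGraph (η \ barOf {a} (setCl ω {a}))).Reachable b c →
      ¬ ((∃ y k : V, (openGraph ω).Reachable a k ∧ (0 : ℝ) < w s(k, y) ∧ (openGraph ω).Reachable b y ∧
            (openGraph (η \ barOf {a} (setCl ω {a}))).Reachable c y) ∧
         (∃ y k : V, (openGraph ω).Reachable a k ∧ (0 : ℝ) < w s(k, y) ∧ (openGraph ω).Reachable c y ∧
            (openGraph (η \ barOf {a} (setCl ω {a}))).Reachable b y))) :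
    ∀ ω η : Set (Sym2 V), (∀ e ∈ ω, (0 : ℝ) < w e) → (∀ e ∈ η, (0 : ℝ) < w e) →
      ¬ (openGraph ω).Reachable a b → ¬ (openGraph ω).Reachable a c →
      ¬ (openGraph ω).Reachable b c → ¬ (openGraph (η \ barOf {a} (setCl ω {a}))).Reachable b c →
      ¬ ((∃ y k : V, (openGraph ω).Reachable a k ∧ (0 : ℝ) < w s(k, y) ∧ (openGraph ω).Reachable b y ∧
            (openGraph (η \ barOf {a} (setCl ω {a}))).Reachable c y) ∧
         (∃ y k : V, (openGraph ω).Reachable a k ∧ (0 : ℝ) < w s(k, y) ∧ (openGraph ω).Reachable c y ∧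
            (openGraph (η \ barOf {a} (setCl ω {a}))).Reachable b y) ∧
         (∃ y k : V, (openGraph ω).Reachable a k ∧ (0 : ℝ) < w s(k, y) ∧ (openGraph ω).Reachable b y ∧
            (openGraph (η \ barOf {a} (setCl ω {a}))).Reachable b y) ∧
         (∃ y k : V, (openGraph ω).Reachable a k ∧ (0 : ℝ) < w s(k, y) ∧ (openGraph ω).Reachable c y ∧
            (openGraph (η \ barOf {a} (setCl ω {a}))).Reachable c y)) :=
  fun ω η hω hη hab hac hbc hbc' h => hndc ω η hω hη hab hac hbc hbc' ⟨h.1, h.2.1⟩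

end General

/-! ### `Fin n` forms -/

/-- **CSQ at `(a; b, c)` under "no quadruple clash" for configurations of positive pairs.**
[cite: Gladkov2024, Thm. 4.3, Def. 4.2, Lemma 3.1, Example 2.5] -/
theorem clusterSquare_le_sq_of_noQuadClash_pos {n : ℕ} (w : Sym2 (Fin n) → unitInterval) (a b c : Fin n)
    (hnqc : ∀ ω η : BondConfig (Fin n), (∀ e ∈ ω, (0 : ℝ) < w e) → (∀ e ∈ η, (0 : ℝ) < w e) →
      ¬ (openGraph ω).Reachable a b → ¬ (openGraph ω).Reachable a c →
      ¬ (openGraph ω).Reachable b c → ¬ (openGraph (η \ barOf {a} (setCl ω {a}))).Reachable b c →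
      ¬ ((∃ y k : Fin n, (openGraph ω).Reachable a k ∧ (0 : ℝ) < w s(k, y) ∧ (openGraph ω).Reachable b y ∧
            (openGraph (η \ barOf {a} (setCl ω {a}))).Reachable c y) ∧
         (∃ y k : Fin n, (openGraph ω).Reachable a k ∧ (0 : ℝ) < w s(k, y) ∧ (openGraph ω).Reachable c y ∧
            (openGraph (η \ barOf {a} (setCl ω {a}))).Reachable b y) ∧
         (∃ y k : Fin n, (openGraph ω).Reachable a k ∧ (0 : ℝ) < w s(k, y) ∧ (openGraph ω).Reachable b y ∧
            (openGraph (η \ barOf {a} (setCl ω {a}))).Reachable b y) ∧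
         (∃ y k : Fin n, (openGraph ω).Reachable a k ∧ (0 : ℝ) < w s(k, y) ∧ (openGraph ω).Reachable c y ∧
            (openGraph (η \ barOf {a} (setCl ω {a}))).Reachable c y))) :
    clusterSquare w a b c ≤ (prodBernoulli w).real (openConn b c)ᶜ ^ 2 := by
  unfold clusterSquare sepOffCluster
  exact setIntegral_sepOff_sq_le_of_noQuadClash_pos w a b c hnqc

/-- **DUU at `(a; b, c)` under "no quadruple clash" for configurations of positive pairs**: `μ(a|b|c)² ≤ μ(a↮b, a↮c)·μ(b↮c)²`.
[cite: Gladkov2024, Thm. 5.2 and Thm. 4.3] -/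
theorem sq_real_split_le_of_noQuadClash_pos {n : ℕ} (w : Sym2 (Fin n) → unitInterval) (a b c : Fin n)
    (hnqc : ∀ ω η : BondConfig (Fin n), (∀ e ∈ ω, (0 : ℝ) < w e) → (∀ e ∈ η, (0 : ℝ) < w e) →
      ¬ (openGraph ω).Reachable a b → ¬ (openGraph ω).Reachable a c →
      ¬ (openGraph ω).Reachable b c → ¬ (openGraph (η \ barOf {a} (setCl ω {a}))).Reachable b c →
      ¬ ((∃ y k : Fin n, (openGraph ω).Reachable a k ∧ (0 : ℝ) < w s(k, y) ∧ (openGraph ω).Reachable b y ∧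
            (openGraph (η \ barOf {a} (setCl ω {a}))).Reachable c y) ∧
         (∃ y k : Fin n, (openGraph ω).Reachable a k ∧ (0 : ℝ) < w s(k, y) ∧ (openGraph ω).Reachable c y ∧
            (openGraph (η \ barOf {a} (setCl ω {a}))).Reachable b y) ∧
         (∃ y k : Fin n, (openGraph ω).Reachable a k ∧ (0 : ℝ) < w s(k, y) ∧ (openGraph ω).Reachable b y ∧
            (openGraph (η \ barOf {a} (setCl ω {a}))).Reachable b y) ∧
         (∃ y k : Fin n, (openGraph ω).Reachable a k ∧ (0 : ℝ) < w s(k, y) ∧ (openGraph ω).Reachable c y ∧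
            (openGraph (η \ barOf {a} (setCl ω {a}))).Reachable c y))) :
    (prodBernoulli w).real ((openConn a b)ᶜ ∩ (openConn a c)ᶜ ∩ (openConn b c)ᶜ) ^ 2 ≤
      (prodBernoulli w).real ((openConn a b)ᶜ ∩ (openConn a c)ᶜ) * (prodBernoulli w).real (openConn b c)ᶜ ^ 2 :=
  (sq_real_split_le_real_mul_clusterSquare w a b c).trans
    (mul_le_mul_of_nonneg_left (clusterSquare_le_sq_of_noQuadClash_pos w a b c hnqc) measureReal_nonneg)

/-- **TS for `{a, b, c}` under "no quadruple clash" at the root `a` for configurations of positive pairs**: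
`μ(a|b|c)² ≤ μ(a↮b)·μ(a↮c)·μ(b↮c)`. [cite: Gladkov2024, Thm. 5.2, Cor. 5.3 (pattern) and Thm. 4.3] -/
theorem tripleSplit_of_noQuadClash_pos {n : ℕ} (w : Sym2 (Fin n) → unitInterval) (a b c : Fin n)
    (hnqc : ∀ ω η : BondConfig (Fin n), (∀ e ∈ ω, (0 : ℝ) < w e) → (∀ e ∈ η, (0 : ℝ) < w e) →
      ¬ (openGraph ω).Reachable a b → ¬ (openGraph ω).Reachable a c →
      ¬ (openGraph ω).Reachable b c → ¬ (openGraph (η \ barOf {a} (setCl ω {a}))).Reachable b c →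
      ¬ ((∃ y k : Fin n, (openGraph ω).Reachable a k ∧ (0 : ℝ) < w s(k, y) ∧ (openGraph ω).Reachable b y ∧
            (openGraph (η \ barOf {a} (setCl ω {a}))).Reachable c y) ∧
         (∃ y k : Fin n, (openGraph ω).Reachable a k ∧ (0 : ℝ) < w s(k, y) ∧ (openGraph ω).Reachable c y ∧
            (openGraph (η \ barOf {a} (setCl ω {a}))).Reachable b y) ∧
         (∃ y k : Fin n, (openGraph ω).Reachable a k ∧ (0 : ℝ) < w s(k, y) ∧ (openGraph ω).Reachable b y ∧
            (openGraph (η \ barOf {a} (setCl ω {a}))).Reachable b y) ∧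
         (∃ y k : Fin n, (openGraph ω).Reachable a k ∧ (0 : ℝ) < w s(k, y) ∧ (openGraph ω).Reachable c y ∧
            (openGraph (η \ barOf {a} (setCl ω {a}))).Reachable c y))) :
    (prodBernoulli w).real ((openConn a b)ᶜ ∩ (openConn a c)ᶜ ∩ (openConn b c)ᶜ) ^ 2 ≤
      (prodBernoulli w).real (openConn a b)ᶜ * (prodBernoulli w).real (openConn a c)ᶜ *
        (prodBernoulli w).real (openConn b c)ᶜ := by
  set μ := prodBernoulli w with hμ
  have hUV : μ.real (openConn b c)ᶜ ≤ μ.real ((openConn a b)ᶜ ∪ (openConn a c)ᶜ) := by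
    refine measureReal_mono (fun ω hω => ?_) (measure_ne_top _ _)
    by_contra hV
    simp only [Set.mem_union, Set.mem_compl_iff, not_or, not_not] at hV
    exact hω (hV.1.symm.trans hV.2)
  have h0 : (0 : ℝ) ≤ μ.real (openConn b c)ᶜ := measureReal_nonneg
  have hD0 : (0 : ℝ) ≤ μ.real ((openConn a b)ᶜ ∩ (openConn a c)ᶜ) := measureReal_nonneg
  have h2 := real_inter_mul_real_union_le n w (openConn a b)ᶜ (openConn a c)ᶜ
  calc μ.real ((openConn a b)ᶜ ∩ (openConn a c)ᶜ ∩ (openConn b c)ᶜ) ^ 2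
      ≤ μ.real ((openConn a b)ᶜ ∩ (openConn a c)ᶜ) * μ.real (openConn b c)ᶜ ^ 2 :=
        sq_real_split_le_of_noQuadClash_pos w a b c hnqc
    _ = μ.real ((openConn a b)ᶜ ∩ (openConn a c)ᶜ) * μ.real (openConn b c)ᶜ * μ.real (openConn b c)ᶜ := by ring
    _ ≤ μ.real ((openConn a b)ᶜ ∩ (openConn a c)ᶜ) * μ.real ((openConn a b)ᶜ ∪ (openConn a c)ᶜ) *
          μ.real (openConn b c)ᶜ :=
        mul_le_mul_of_nonneg_right (mul_le_mul_of_nonneg_left hUV hD0) h0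
    _ ≤ μ.real (openConn a b)ᶜ * μ.real (openConn a c)ᶜ * μ.real (openConn b c)ᶜ := mul_le_mul_of_nonneg_right h2 h0

end Consts
end Summit.CriticalPhenomena.PercolationContinuityZ3.Theorems
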